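import Summits.CriticalPhenomena.CardyFormulaZ2.Theorems.CardyBoundaryCoulombGasHalfPlaneMarkDensityLawSelfDualityExact

/-!
# `HalfPlaneMarkDensityLaw` (crux stmt-CriticalPhenomena-5661), line `Sketch`, gap closing:
# stub `stub_dualStep_erase` (G2) — erasing far-left edges does not create dual steps on the right

Dual lattice convention of the tree (`Crossings.lean`, `PlanarDuality.lean`): the dual vertex
`z : Site 2` is the unit face with lower-left corner `z`, `dualConfig ω = E(ℤ²) ∖ dualEdge '' ω`,
and for adjacent faces `z`, `z'` the dual step `s(z, z')` crosses the primal edge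
`sepEdge z z' = s(z ⊔ z', z ⊔ z' + eᵢ)`, both of whose endpoints have first coordinate at least
`max z₀ z'₀` (`sepEdge_apply_zero_le`).  By `Z2HalfPlane.mem_dualConfig_iff_sepEdge_notMem`
(valid for every configuration) a dual step is dual-open iff the primal edge it crosses is closed.

Let `L = {e | ∃ w ∈ e, w₀ < α'}` be the pairs with an endpoint strictly left of the column `α'`.
If `s(z, z')` is a dual-open step of `(ω ∖ L)*` then `sepEdge z z' ∉ ω ∖ L`, i.e.
`sepEdge z z' ∉ ω` or `sepEdge z z' ∈ L`; the latter is impossible as soon as one of the two faces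
has `x₀ ≥ α'`, since then every endpoint of `sepEdge z z'` has `x₀ ≥ max z₀ z'₀ ≥ α'`.  Hence
`sepEdge z z' ∉ ω`, i.e. `s(z, z')` is a dual-open step of `ω*`.
-/

noncomputable section

namespace Summit.CriticalPhenomena.CardyFormulaZ2.Cruxes.HalfPlaneMarkDensityLaw.SketchLine

open Literature.Probability.Percolation Literature.Probability.LatticeModels
open Literature.Probability.Percolation.Z2HalfPlane (leg Far faceBox oneArm)
open MeasureTheory Filter Set SimpleGraph
open scoped Topology
open Summit.CriticalPhenomena.CardyFormulaZ2.Theorems.HalfPlaneMarkDensityLaw.Negative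

namespace GapClose

/-- The separating edge of two faces, one of which lies in the closed half-plane `{x₀ ≥ α'}`, has
no endpoint strictly left of the column `α'`. [folklore] -/
lemma sepEdge_notMem_leftEdges {α' : ℤ} {z z' : Site 2} (hα : α' ≤ z 0 ∨ α' ≤ z' 0) :
    sepEdge z z' ∉ {e : Sym2 (Site 2) | ∃ w ∈ e, w 0 < α'} := by
  rintro ⟨w, hw, hwα⟩
  have h0 := (sepEdge_apply_zero_le hw).2
  have h1 := le_max_left (z 0) (z' 0)
  have h2 := le_max_right (z 0) (z' 0)
  omega

/-- **G2 (deterministic)**: a dual-open step of `(ω ∖ L)*`, `L` the pairs with an endpoint in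
`{x₀ < α'}`, between two adjacent faces one of which has `x₀ ≥ α'`, is a dual-open step of `ω*`:
the primal edge it crosses has both endpoints at `x₀ ≥ α'`, so it is not in `L`, and being closed
in `ω ∖ L` it is closed in `ω`. [folklore] -/
theorem stub_dualStep_erase :
    ∀ (ω : BondConfig (Site 2)) (α' : ℤ) (z z' : Site 2), (zdGraph 2).Adj z z' →
      s(z, z') ∈ dualConfig (ω \ {e | ∃ w ∈ e, w 0 < α'}) → (α' ≤ z 0 ∨ α' ≤ z' 0) →
      s(z, z') ∈ dualConfig ω := by
  intro ω α' z z' hzz' hmem hα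
  rw [Z2HalfPlane.mem_dualConfig_iff_sepEdge_notMem hzz'] at hmem ⊢
  exact fun hω => hmem ⟨hω, sepEdge_notMem_leftEdges hα⟩

end GapClose

end Summit.CriticalPhenomena.CardyFormulaZ2.Cruxes.HalfPlaneMarkDensityLaw.SketchLine
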